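import Summits.QuantumFields.YangMills.Theorems.FluctuationComparisonRegPrIntLOrganTangentLawResponseLipAE
import Summits.QuantumFields.YangMills.Theorems.FluctuationComparisonRegPrIntLOrganTangentLawEdgeIntegrationLip
import HarnessLib

/-!
# Crux `FluctuationComparisonRegPrIntL` (stmt-QuantumFields-20520, rung R3), PATH-B organ, H-currency cone — (L37a) THE D3∕D4 LAW EDGE BRICKS, «AE» EDITION
# (the a.e.-`s` road of LEAD w3 g27 №3 (C) ∕ №4: (Diff₀) and the score witness `wN′` are GONE; companion of ✓(L27b) p817001 over LEAD's (C1) `…AEDifferentiableFamily` ∕ (C2) `…LawResponseLipAE`)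

Cell `ym3-torus` (YM ladder rung R3 = continuum `SU(2)` Yang–Mills on the three-torus — a RUNG: NOT d = 4, NOT infinite volume, NOT a mass gap, NOT Clay).
Width seat `ym-ust-20520-w5` (gen 24), `--supports stmt-QuantumFields-20520 --as helper`, count-neutral, no registry ∕ binder ∕ `Lines/` edit, DEFINITION-FREE,
default heartbeats.  Over (C2) `abs_normMean_one_sub_zero_le_of_lip_ae` ∕ `abs_normCov_one_sub_zero_le_of_lip_ae` (LEAD w3 g27), (C1) `ae_ae_hasDerivAt_deriv_of_lipschitzOn`,
✓(L27a) `cut_null_of_nonneg`, ✓(L24)∕(L26a) score identities `normMean_deriv_eq_cov_of_null` ∕ `normCov_deriv_eq_cum3_of_null`, ✓(L23b)∕(L25)∕(L26b)∕(L27b) docking lemmas.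

WHAT.  ✓(L27b)'s bricks `abs_lawEdge_wgt_le_of_lip`, `lawEdgeClause_of_covKernel_of_lip`, `covEdgeClause_of_cum3Kernel_of_lip` with EXACTLY these binder changes and the SAME
conclusions (character for character): `[SFinite τ]`; the fibre-measurability pair `hm`∕`hm′` ↦ ONE joint measurability `hwm : Measurable (fun p : ℝ × Zc => wNum … t (X p.1) p.2)`;
the score witness `wN′` and the pointwise clause (Diff₀) `∀ s ∈ Icc 0 1, ∀ᵐ z, HasDerivAt … (wN′ s z) s` DELETED; the SCORE-form kernel read `∀ᵐ s ∂volume, s ∈ Icc 0 1 → …` with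
the canonical score `deriv (fun s => wNum … t (X s) z) s`.  Inside: (C1) supplies, for a.e. `s ∈ [0,1]`, the a.e.-`z` derivative (from (Lip) + joint measurability — Rademacher
+ Fubini on a product-measurable differentiability set), ✓`cut_null_of_nonneg` the cut clause at those `s`, the identities turn SCORE form into RAW form a.e., and (C2)'s AE
engines (absolute continuity + `AbsolutelyContinuousOnInterval.integral_deriv_eq_sub`) close.  ★`abs_lawEdge_wgt_le_of_lip_ae` · ★★★`lawEdgeClause_of_covKernel_of_lip_ae`
((L1ʲ-h) per square) · ★★★`covEdgeClause_of_cum3Kernel_of_lip_ae` ((JV3-h′) per square).  The squares follow in (L37b); the AE docks (A2′ blocks) in (L37c).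

HONEST FRAMING: calculus [folklore] over HYPOTHESIS shapes; nothing of Bałaban's analysis is asserted or proved; `SpreadFibreLawH(J)(sq)` ∕ `OrganDischargeInputsHJ(sq)` exactly as
open; the five registered stubs of `Lines/semiclassical_s2beta.lean`, crux 20520 and `YM3TorusSU2` are NOT proved; registry untouched; rung R3 = SU(2) YM₃ on T³ at fixed lattice
data — NOT d = 4, NOT infinite volume, NOT a mass gap, NOT Clay; the Yang–Mills mass gap is NOT proved.  [folklore].
-/

set_option autoImplicit false

noncomputable section

namespace Summit.QuantumFields.YangMills.Theorems.OrganTangentLawEdgeIntegrationLipAE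

open MeasureTheory Filter Topology Set Function
open scoped ENNReal
open Literature.MathematicalPhysics.QuantumFieldTheory.Balaban1983to89 T3ContinuumYM3Torus T3NestedUnitLaws T3UnitLawDensityEML T4Continuum BalabanUVClass
open T4CubeChartExp (expPt)
open Summit.QuantumFields.YangMills.Theorems.FluctuationComparisonRegPrIntLRunpairOrganFibreLaw (wNum wgt)
open Summit.QuantumFields.YangMills.Theorems.OrganTangentLawEdgeResponse
open Summit.QuantumFields.YangMills.Theorems.OrganTangentLawSquareResponse
open Summit.QuantumFields.YangMills.Theorems.OrganTangentLawEdgeResponseDock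
open Summit.QuantumFields.YangMills.Theorems.OrganTangentLawCumulantResponse
open Summit.QuantumFields.YangMills.Theorems.OrganTangentLawEdgeIntegration
open Summit.QuantumFields.YangMills.Theorems.OrganTangentLawCumulantIntegration
open Summit.QuantumFields.YangMills.Theorems.OrganTangentLawResponseLip
open Summit.QuantumFields.YangMills.Theorems.OrganTangentLawEdgeIntegrationLip (integrable_mul_wNum_of_wgt)
open Summit.QuantumFields.YangMills.Theorems.OrganTangentAEDifferentiableFamily (ae_ae_hasDerivAt_deriv_of_lipschitzOn)
open Summit.QuantumFields.YangMills.Theorems.OrganTangentLawResponseLipAE (abs_normMean_one_sub_zero_le_of_lip_ae abs_normCov_one_sub_zero_le_of_lip_ae)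

section Edge

/-- ★ **THE LAW EDGE ALONG A LAW PATH, DOCKED, AE EDITION** (conclusion = ✓`abs_lawEdge_wgt_le_of_lip`'s). [folklore] -/
theorem abs_lawEdge_wgt_le_of_lip_ae (F : T3Family) (γ b₀ p₀ : ℝ) (j Ts : ℕ)
    (ρ ρ' : (i : ℕ) → GaugeField (F.P i) 0 ↥(Matrix.specialUnitaryGroup (Fin 2) ℂ) → ℝ) {Zc : Type} [MeasurableSpace Zc] (τ : Measure Zc) [SFinite τ]
    (Φ : GaugeField (F.P j) 0 ↥(Matrix.specialUnitaryGroup (Fin 2) ℂ) × Zc → GaugeField (F.P Ts) 0 ↥(Matrix.specialUnitaryGroup (Fin 2) ℂ))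
    (J : GaugeField (F.P j) 0 ↥(Matrix.specialUnitaryGroup (Fin 2) ℂ) × Zc → NNReal) (t : ℝ)
    (X : ℝ → GaugeField (F.P j) 0 ↥(Matrix.specialUnitaryGroup (Fin 2) ℂ)) (f : Zc → ℝ)
    {U : Set ℝ} (hU : IsOpen U) (hUI : Icc (0:ℝ) 1 ⊆ U)
    (hf : AEStronglyMeasurable f τ) (hwm : Measurable (fun p : ℝ × Zc => wNum F γ b₀ p₀ j Ts ρ ρ' Φ J t (X p.1) p.2))
    (hint : ∀ s ∈ Icc (0:ℝ) 1, Integrable (fun z => wNum F γ b₀ p₀ j Ts ρ ρ' Φ J t (X s) z) τ)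
    (hintf : ∀ s ∈ Icc (0:ℝ) 1, Integrable (fun z => f z * wNum F γ b₀ p₀ j Ts ρ ρ' Φ J t (X s) z) τ)
    {bound : Zc → ℝ} (hlip : ∀ᵐ z ∂τ, LipschitzOnWith (Real.nnabs (bound z)) (fun s => wNum F γ b₀ p₀ j Ts ρ ρ' Φ J t (X s) z) U) (hbint : Integrable bound τ)
    {boundf : Zc → ℝ} (hlipf : ∀ᵐ z ∂τ, LipschitzOnWith (Real.nnabs (boundf z)) (fun s => f z * wNum F γ b₀ p₀ j Ts ρ ρ' Φ J t (X s) z) U) (hbfint : Integrable boundf τ)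
    (hZ : ∀ s ∈ Icc (0:ℝ) 1, ∫ z, wNum F γ b₀ p₀ j Ts ρ ρ' Φ J t (X s) z ∂τ ≠ 0) {ℓ : ℝ}
    (hcov : ∀ᵐ s ∂(volume : Measure ℝ), s ∈ Icc (0:ℝ) 1 → |(∫ z, f z * deriv (fun s => wNum F γ b₀ p₀ j Ts ρ ρ' Φ J t (X s) z) s ∂τ) / (∫ z, wNum F γ b₀ p₀ j Ts ρ ρ' Φ J t (X s) z ∂τ)
        - ((∫ z, f z * wNum F γ b₀ p₀ j Ts ρ ρ' Φ J t (X s) z ∂τ) / (∫ z, wNum F γ b₀ p₀ j Ts ρ ρ' Φ J t (X s) z ∂τ))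
          * ((∫ z, deriv (fun s => wNum F γ b₀ p₀ j Ts ρ ρ' Φ J t (X s) z) s ∂τ) / (∫ z, wNum F γ b₀ p₀ j Ts ρ ρ' Φ J t (X s) z ∂τ))| ≤ ℓ) :
    |(∫ z, f z * (wgt F γ b₀ p₀ j Ts ρ ρ' τ Φ J t) (X 1) z ∂τ) - (∫ z, f z * (wgt F γ b₀ p₀ j Ts ρ ρ' τ Φ J t) (X 0) z ∂τ)| ≤ ℓ := by
  rw [integral_mul_wgt_eq_div, integral_mul_wgt_eq_div]
  exact abs_normMean_one_sub_zero_le_of_lip_ae (w := fun s z => wNum F γ b₀ p₀ j Ts ρ ρ' Φ J t (X s) z) hU hUI hf hwm hint hintf hlip hbint hlipf hbfint hZ hcov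

/-- ★★★ **THE D3 INTEGRATION BRICK FOR (L1ʲ-h), AE EDITION** (conclusion = ✓`lawEdgeClause_of_covKernel_of_lip`'s VERBATIM; no `wN′`, no (Diff₀), kernel `∀ᵐ s`). [folklore] -/
theorem lawEdgeClause_of_covKernel_of_lip_ae (F : T3Family) (γ b₀ p₀ : ℝ) (j Ts : ℕ)
    (ρ ρ' : (i : ℕ) → GaugeField (F.P i) 0 ↥(Matrix.specialUnitaryGroup (Fin 2) ℂ) → ℝ) {Zc : Type} [MeasurableSpace Zc] (τ : Measure Zc) [SFinite τ]
    (Φ : GaugeField (F.P j) 0 ↥(Matrix.specialUnitaryGroup (Fin 2) ℂ) × Zc → GaugeField (F.P Ts) 0 ↥(Matrix.specialUnitaryGroup (Fin 2) ℂ))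
    (J : GaugeField (F.P j) 0 ↥(Matrix.specialUnitaryGroup (Fin 2) ℂ) × Zc → NNReal) (t : ℝ)
    (U₁ V₁ U₂ W₂ : GaugeField (F.P j) 0 ↥(Matrix.specialUnitaryGroup (Fin 2) ℂ))
    (X : ℝ → GaugeField (F.P j) 0 ↥(Matrix.specialUnitaryGroup (Fin 2) ℂ)) (hX0 : X 0 = U₂) (hX1 : X 1 = W₂)
    {U : Set ℝ} (hU : IsOpen U) (hUI : Icc (0:ℝ) 1 ⊆ U)
    (hw0 : ∀ s z, 0 ≤ wNum F γ b₀ p₀ j Ts ρ ρ' Φ J t (X s) z)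
    (hmF : AEStronglyMeasurable (fun z => ((Real.log (ρ Ts (Φ (V₁, z))) - Real.log (ρ' Ts (Φ (V₁, z)))) - (Real.log (ρ Ts (Φ (U₁, z))) - Real.log (ρ' Ts (Φ (U₁, z)))))) τ)
    (hwm : Measurable (fun p : ℝ × Zc => wNum F γ b₀ p₀ j Ts ρ ρ' Φ J t (X p.1) p.2))
    (hi : ∀ s ∈ Icc (0:ℝ) 1, Integrable (fun z => wNum F γ b₀ p₀ j Ts ρ ρ' Φ J t (X s) z) τ)
    (hiU : ∀ s ∈ Icc (0:ℝ) 1, Integrable (fun z => (Real.log (ρ Ts (Φ (U₁, z))) - Real.log (ρ' Ts (Φ (U₁, z)))) * wNum F γ b₀ p₀ j Ts ρ ρ' Φ J t (X s) z) τ)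
    (hiV : ∀ s ∈ Icc (0:ℝ) 1, Integrable (fun z => (Real.log (ρ Ts (Φ (V₁, z))) - Real.log (ρ' Ts (Φ (V₁, z)))) * wNum F γ b₀ p₀ j Ts ρ ρ' Φ J t (X s) z) τ)
    {bound : Zc → ℝ} (hlip : ∀ᵐ z ∂τ, LipschitzOnWith (Real.nnabs (bound z)) (fun s => wNum F γ b₀ p₀ j Ts ρ ρ' Φ J t (X s) z) U) (hbi : Integrable bound τ)
    {boundG : Zc → ℝ} (hlipG : ∀ᵐ z ∂τ, LipschitzOnWith (Real.nnabs (boundG z)) (fun s => ((Real.log (ρ Ts (Φ (V₁, z))) - Real.log (ρ' Ts (Φ (V₁, z)))) - (Real.log (ρ Ts (Φ (U₁, z))) - Real.log (ρ' Ts (Φ (U₁, z))))) * wNum F γ b₀ p₀ j Ts ρ ρ' Φ J t (X s) z) U) (hbGi : Integrable boundG τ)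
    (hZ : ∀ s ∈ Icc (0:ℝ) 1, ∫ z, wNum F γ b₀ p₀ j Ts ρ ρ' Φ J t (X s) z ∂τ ≠ 0) {ℓ : ℝ}
    (hcov : ∀ᵐ s ∂(volume : Measure ℝ), s ∈ Icc (0:ℝ) 1 →
      |(∫ z, ((Real.log (ρ Ts (Φ (V₁, z))) - Real.log (ρ' Ts (Φ (V₁, z)))) - (Real.log (ρ Ts (Φ (U₁, z))) - Real.log (ρ' Ts (Φ (U₁, z))))) * (deriv (fun s => wNum F γ b₀ p₀ j Ts ρ ρ' Φ J t (X s) z) s / wNum F γ b₀ p₀ j Ts ρ ρ' Φ J t (X s) z) * (wNum F γ b₀ p₀ j Ts ρ ρ' Φ J t (X s) z / ∫ z', wNum F γ b₀ p₀ j Ts ρ ρ' Φ J t (X s) z' ∂τ) ∂τ)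
        - (∫ z, ((Real.log (ρ Ts (Φ (V₁, z))) - Real.log (ρ' Ts (Φ (V₁, z)))) - (Real.log (ρ Ts (Φ (U₁, z))) - Real.log (ρ' Ts (Φ (U₁, z))))) * (wNum F γ b₀ p₀ j Ts ρ ρ' Φ J t (X s) z / ∫ z', wNum F γ b₀ p₀ j Ts ρ ρ' Φ J t (X s) z' ∂τ) ∂τ)
          * (∫ z, (deriv (fun s => wNum F γ b₀ p₀ j Ts ρ ρ' Φ J t (X s) z) s / wNum F γ b₀ p₀ j Ts ρ ρ' Φ J t (X s) z) * (wNum F γ b₀ p₀ j Ts ρ ρ' Φ J t (X s) z / ∫ z', wNum F γ b₀ p₀ j Ts ρ ρ' Φ J t (X s) z' ∂τ) ∂τ)| ≤ ℓ) :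
    Integrable (fun z => (Real.log (ρ Ts (Φ (U₁, z))) - Real.log (ρ' Ts (Φ (U₁, z)))) * (wgt F γ b₀ p₀ j Ts ρ ρ' τ Φ J t) U₂ z) τ ∧
    Integrable (fun z => (Real.log (ρ Ts (Φ (V₁, z))) - Real.log (ρ' Ts (Φ (V₁, z)))) * (wgt F γ b₀ p₀ j Ts ρ ρ' τ Φ J t) U₂ z) τ ∧
    Integrable (fun z => (Real.log (ρ Ts (Φ (U₁, z))) - Real.log (ρ' Ts (Φ (U₁, z)))) * (wgt F γ b₀ p₀ j Ts ρ ρ' τ Φ J t) W₂ z) τ ∧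
    Integrable (fun z => (Real.log (ρ Ts (Φ (V₁, z))) - Real.log (ρ' Ts (Φ (V₁, z)))) * (wgt F γ b₀ p₀ j Ts ρ ρ' τ Φ J t) W₂ z) τ ∧
    |((∫ z, (Real.log (ρ Ts (Φ (V₁, z))) - Real.log (ρ' Ts (Φ (V₁, z)))) * (wgt F γ b₀ p₀ j Ts ρ ρ' τ Φ J t) W₂ z ∂τ)
        - (∫ z, (Real.log (ρ Ts (Φ (U₁, z))) - Real.log (ρ' Ts (Φ (U₁, z)))) * (wgt F γ b₀ p₀ j Ts ρ ρ' τ Φ J t) W₂ z ∂τ))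
      - ((∫ z, (Real.log (ρ Ts (Φ (V₁, z))) - Real.log (ρ' Ts (Φ (V₁, z)))) * (wgt F γ b₀ p₀ j Ts ρ ρ' τ Φ J t) U₂ z ∂τ)
        - (∫ z, (Real.log (ρ Ts (Φ (U₁, z))) - Real.log (ρ' Ts (Φ (U₁, z)))) * (wgt F γ b₀ p₀ j Ts ρ ρ' τ Φ J t) U₂ z ∂τ))| ≤ ℓ := by
  have h1 : (1:ℝ) ∈ Icc (0:ℝ) 1 := ⟨zero_le_one, le_rfl⟩
  have h0 : (0:ℝ) ∈ Icc (0:ℝ) 1 := ⟨le_rfl, zero_le_one⟩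
  have iUU := integrable_mul_wgt_of_wNum F γ b₀ p₀ j Ts ρ ρ' τ Φ J t (X 0) _ (hiU 0 h0)
  have iVU := integrable_mul_wgt_of_wNum F γ b₀ p₀ j Ts ρ ρ' τ Φ J t (X 0) _ (hiV 0 h0)
  have iUW := integrable_mul_wgt_of_wNum F γ b₀ p₀ j Ts ρ ρ' τ Φ J t (X 1) _ (hiU 1 h1)
  have iVW := integrable_mul_wgt_of_wNum F γ b₀ p₀ j Ts ρ ρ' τ Φ J t (X 1) _ (hiV 1 h1)
  rw [hX0] at iUU iVU
  rw [hX1] at iUW iVW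
  have hiG : ∀ s ∈ Icc (0:ℝ) 1, Integrable (fun z => ((Real.log (ρ Ts (Φ (V₁, z))) - Real.log (ρ' Ts (Φ (V₁, z)))) - (Real.log (ρ Ts (Φ (U₁, z))) - Real.log (ρ' Ts (Φ (U₁, z))))) * wNum F γ b₀ p₀ j Ts ρ ρ' Φ J t (X s) z) τ := by
    intro s hs
    have e : (fun z => ((Real.log (ρ Ts (Φ (V₁, z))) - Real.log (ρ' Ts (Φ (V₁, z)))) - (Real.log (ρ Ts (Φ (U₁, z))) - Real.log (ρ' Ts (Φ (U₁, z))))) * wNum F γ b₀ p₀ j Ts ρ ρ' Φ J t (X s) z)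
        = fun z => (Real.log (ρ Ts (Φ (V₁, z))) - Real.log (ρ' Ts (Φ (V₁, z)))) * wNum F γ b₀ p₀ j Ts ρ ρ' Φ J t (X s) z - (Real.log (ρ Ts (Φ (U₁, z))) - Real.log (ρ' Ts (Φ (U₁, z)))) * wNum F γ b₀ p₀ j Ts ρ ρ' Φ J t (X s) z := by
      funext z; ring
    rw [e]
    exact (hiV s hs).sub (hiU s hs)
  -- the cut clause from non-negativity, then the kernel in raw form
  have hraw : ∀ᵐ s ∂(volume : Measure ℝ), s ∈ Icc (0:ℝ) 1 →
      |(∫ z, ((Real.log (ρ Ts (Φ (V₁, z))) - Real.log (ρ' Ts (Φ (V₁, z)))) - (Real.log (ρ Ts (Φ (U₁, z))) - Real.log (ρ' Ts (Φ (U₁, z))))) * deriv (fun s => wNum F γ b₀ p₀ j Ts ρ ρ' Φ J t (X s) z) s ∂τ) / (∫ z, wNum F γ b₀ p₀ j Ts ρ ρ' Φ J t (X s) z ∂τ)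
        - ((∫ z, ((Real.log (ρ Ts (Φ (V₁, z))) - Real.log (ρ' Ts (Φ (V₁, z)))) - (Real.log (ρ Ts (Φ (U₁, z))) - Real.log (ρ' Ts (Φ (U₁, z))))) * wNum F γ b₀ p₀ j Ts ρ ρ' Φ J t (X s) z ∂τ) / (∫ z, wNum F γ b₀ p₀ j Ts ρ ρ' Φ J t (X s) z ∂τ))
          * ((∫ z, deriv (fun s => wNum F γ b₀ p₀ j Ts ρ ρ' Φ J t (X s) z) s ∂τ) / (∫ z, wNum F γ b₀ p₀ j Ts ρ ρ' Φ J t (X s) z ∂τ))| ≤ ℓ := by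
    filter_upwards [ae_ae_hasDerivAt_deriv_of_lipschitzOn (w := fun s z => wNum F γ b₀ p₀ j Ts ρ ρ' Φ J t (X s) z) hU hUI τ hwm hlip, hcov] with s hs hc hsI
    have hnull := cut_null_of_nonneg (w := fun s z => wNum F γ b₀ p₀ j Ts ρ ρ' Φ J t (X s) z) (w'₀ := fun z => deriv (fun s => wNum F γ b₀ p₀ j Ts ρ ρ' Φ J t (X s) z) s) (s₀ := s) hw0 (hs hsI)
    rw [normMean_deriv_eq_cov_of_null (w := fun s z => wNum F γ b₀ p₀ j Ts ρ ρ' Φ J t (X s) z) (w' := fun s z => deriv (fun s => wNum F γ b₀ p₀ j Ts ρ ρ' Φ J t (X s) z) s) (G := fun z => ((Real.log (ρ Ts (Φ (V₁, z))) - Real.log (ρ' Ts (Φ (V₁, z)))) - (Real.log (ρ Ts (Φ (U₁, z))) - Real.log (ρ' Ts (Φ (U₁, z)))))) (s₀ := s) hnull]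
    exact hc hsI
  have hedge := abs_lawEdge_wgt_le_of_lip_ae F γ b₀ p₀ j Ts ρ ρ' τ Φ J t X (fun z => ((Real.log (ρ Ts (Φ (V₁, z))) - Real.log (ρ' Ts (Φ (V₁, z)))) - (Real.log (ρ Ts (Φ (U₁, z))) - Real.log (ρ' Ts (Φ (U₁, z)))))) hU hUI hmF hwm hi hiG hlip hbi hlipG hbGi hZ hraw
  rw [hX0, hX1] at hedge
  have eW : (∫ z, ((Real.log (ρ Ts (Φ (V₁, z))) - Real.log (ρ' Ts (Φ (V₁, z)))) - (Real.log (ρ Ts (Φ (U₁, z))) - Real.log (ρ' Ts (Φ (U₁, z))))) * (wgt F γ b₀ p₀ j Ts ρ ρ' τ Φ J t) W₂ z ∂τ)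
      = (∫ z, (Real.log (ρ Ts (Φ (V₁, z))) - Real.log (ρ' Ts (Φ (V₁, z)))) * (wgt F γ b₀ p₀ j Ts ρ ρ' τ Φ J t) W₂ z ∂τ) - (∫ z, (Real.log (ρ Ts (Φ (U₁, z))) - Real.log (ρ' Ts (Φ (U₁, z)))) * (wgt F γ b₀ p₀ j Ts ρ ρ' τ Φ J t) W₂ z ∂τ) := by
    rw [← integral_sub iVW iUW]
    exact integral_congr_ae (Eventually.of_forall fun z => by ring)
  have eU : (∫ z, ((Real.log (ρ Ts (Φ (V₁, z))) - Real.log (ρ' Ts (Φ (V₁, z)))) - (Real.log (ρ Ts (Φ (U₁, z))) - Real.log (ρ' Ts (Φ (U₁, z))))) * (wgt F γ b₀ p₀ j Ts ρ ρ' τ Φ J t) U₂ z ∂τ)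
      = (∫ z, (Real.log (ρ Ts (Φ (V₁, z))) - Real.log (ρ' Ts (Φ (V₁, z)))) * (wgt F γ b₀ p₀ j Ts ρ ρ' τ Φ J t) U₂ z ∂τ) - (∫ z, (Real.log (ρ Ts (Φ (U₁, z))) - Real.log (ρ' Ts (Φ (U₁, z)))) * (wgt F γ b₀ p₀ j Ts ρ ρ' τ Φ J t) U₂ z ∂τ) := by
    rw [← integral_sub iVU iUU]
    exact integral_congr_ae (Eventually.of_forall fun z => by ring)
  rw [eW, eU] at hedge
  exact ⟨iUU, iVU, iUW, iVW, hedge⟩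

end Edge

section CovEdge

/-- ★★★ **THE D4 LAW-SIDE BRICK FOR (JV3-h′), AE EDITION** (conclusion = ✓`covEdgeClause_of_cum3Kernel_of_lip`'s VERBATIM). [folklore] -/
theorem covEdgeClause_of_cum3Kernel_of_lip_ae (F : T3Family) (γ b₀ p₀ : ℝ) (j Ts : ℕ)
    (ρ ρ' : (i : ℕ) → GaugeField (F.P i) 0 ↥(Matrix.specialUnitaryGroup (Fin 2) ℂ) → ℝ) {Zc : Type} [MeasurableSpace Zc] (τ : Measure Zc) [SFinite τ]
    (Φ : GaugeField (F.P j) 0 ↥(Matrix.specialUnitaryGroup (Fin 2) ℂ) × Zc → GaugeField (F.P Ts) 0 ↥(Matrix.specialUnitaryGroup (Fin 2) ℂ))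
    (J : GaugeField (F.P j) 0 ↥(Matrix.specialUnitaryGroup (Fin 2) ℂ) × Zc → NNReal) (t : ℝ)
    (U₁ V₁ U₂ W₂ : GaugeField (F.P j) 0 ↥(Matrix.specialUnitaryGroup (Fin 2) ℂ))
    (X : ℝ → GaugeField (F.P j) 0 ↥(Matrix.specialUnitaryGroup (Fin 2) ℂ)) (hX0 : X 0 = U₂) (hX1 : X 1 = W₂)
    {U : Set ℝ} (hU : IsOpen U) (hUI : Icc (0:ℝ) 1 ⊆ U)
    (hw0 : ∀ s z, 0 ≤ wNum F γ b₀ p₀ j Ts ρ ρ' Φ J t (X s) z)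
    (hmD : AEStronglyMeasurable (fun z => ((Real.log (ρ Ts (Φ (V₁, z))) - Real.log (ρ' Ts (Φ (V₁, z)))) - (Real.log (ρ Ts (Φ (U₁, z))) - Real.log (ρ' Ts (Φ (U₁, z)))))) τ) (hmS : AEStronglyMeasurable (fun z => ((Real.log (ρ Ts (Φ (V₁, z))) - Real.log (ρ' Ts (Φ (V₁, z)))) + (Real.log (ρ Ts (Φ (U₁, z))) - Real.log (ρ' Ts (Φ (U₁, z)))))) τ)
    (hwm : Measurable (fun p : ℝ × Zc => wNum F γ b₀ p₀ j Ts ρ ρ' Φ J t (X p.1) p.2))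
    (hi : ∀ s ∈ Icc (0:ℝ) 1, Integrable (fun z => wNum F γ b₀ p₀ j Ts ρ ρ' Φ J t (X s) z) τ)
    (hiD : ∀ s ∈ Icc (0:ℝ) 1, Integrable (fun z => ((Real.log (ρ Ts (Φ (V₁, z))) - Real.log (ρ' Ts (Φ (V₁, z)))) - (Real.log (ρ Ts (Φ (U₁, z))) - Real.log (ρ' Ts (Φ (U₁, z))))) * wNum F γ b₀ p₀ j Ts ρ ρ' Φ J t (X s) z) τ)
    (hiS : ∀ s ∈ Icc (0:ℝ) 1, Integrable (fun z => ((Real.log (ρ Ts (Φ (V₁, z))) - Real.log (ρ' Ts (Φ (V₁, z)))) + (Real.log (ρ Ts (Φ (U₁, z))) - Real.log (ρ' Ts (Φ (U₁, z))))) * wNum F γ b₀ p₀ j Ts ρ ρ' Φ J t (X s) z) τ)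
    (hiDS : ∀ s ∈ Icc (0:ℝ) 1, Integrable (fun z => (((Real.log (ρ Ts (Φ (V₁, z))) - Real.log (ρ' Ts (Φ (V₁, z)))) - (Real.log (ρ Ts (Φ (U₁, z))) - Real.log (ρ' Ts (Φ (U₁, z))))) * ((Real.log (ρ Ts (Φ (V₁, z))) - Real.log (ρ' Ts (Φ (V₁, z)))) + (Real.log (ρ Ts (Φ (U₁, z))) - Real.log (ρ' Ts (Φ (U₁, z)))))) * wNum F γ b₀ p₀ j Ts ρ ρ' Φ J t (X s) z) τ)
    {bound : Zc → ℝ} (hlip : ∀ᵐ z ∂τ, LipschitzOnWith (Real.nnabs (bound z)) (fun s => wNum F γ b₀ p₀ j Ts ρ ρ' Φ J t (X s) z) U) (hbi : Integrable bound τ)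
    {bD : Zc → ℝ} (hlipD : ∀ᵐ z ∂τ, LipschitzOnWith (Real.nnabs (bD z)) (fun s => ((Real.log (ρ Ts (Φ (V₁, z))) - Real.log (ρ' Ts (Φ (V₁, z)))) - (Real.log (ρ Ts (Φ (U₁, z))) - Real.log (ρ' Ts (Φ (U₁, z))))) * wNum F γ b₀ p₀ j Ts ρ ρ' Φ J t (X s) z) U) (hbDi : Integrable bD τ)
    {bS : Zc → ℝ} (hlipS : ∀ᵐ z ∂τ, LipschitzOnWith (Real.nnabs (bS z)) (fun s => ((Real.log (ρ Ts (Φ (V₁, z))) - Real.log (ρ' Ts (Φ (V₁, z)))) + (Real.log (ρ Ts (Φ (U₁, z))) - Real.log (ρ' Ts (Φ (U₁, z))))) * wNum F γ b₀ p₀ j Ts ρ ρ' Φ J t (X s) z) U) (hbSi : Integrable bS τ)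
    {bDS : Zc → ℝ} (hlipDS : ∀ᵐ z ∂τ, LipschitzOnWith (Real.nnabs (bDS z)) (fun s => (((Real.log (ρ Ts (Φ (V₁, z))) - Real.log (ρ' Ts (Φ (V₁, z)))) - (Real.log (ρ Ts (Φ (U₁, z))) - Real.log (ρ' Ts (Φ (U₁, z))))) * ((Real.log (ρ Ts (Φ (V₁, z))) - Real.log (ρ' Ts (Φ (V₁, z)))) + (Real.log (ρ Ts (Φ (U₁, z))) - Real.log (ρ' Ts (Φ (U₁, z)))))) * wNum F γ b₀ p₀ j Ts ρ ρ' Φ J t (X s) z) U) (hbDSi : Integrable bDS τ)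
    (hZ : ∀ s ∈ Icc (0:ℝ) 1, ∫ z, wNum F γ b₀ p₀ j Ts ρ ρ' Φ J t (X s) z ∂τ ≠ 0) {ℓ : ℝ}
    (hcum : ∀ᵐ s ∂(volume : Measure ℝ), s ∈ Icc (0:ℝ) 1 →
      |(((∫ z, (((Real.log (ρ Ts (Φ (V₁, z))) - Real.log (ρ' Ts (Φ (V₁, z)))) - (Real.log (ρ Ts (Φ (U₁, z))) - Real.log (ρ' Ts (Φ (U₁, z))))) * ((Real.log (ρ Ts (Φ (V₁, z))) - Real.log (ρ' Ts (Φ (V₁, z)))) + (Real.log (ρ Ts (Φ (U₁, z))) - Real.log (ρ' Ts (Φ (U₁, z)))))) * (deriv (fun s => wNum F γ b₀ p₀ j Ts ρ ρ' Φ J t (X s) z) s / wNum F γ b₀ p₀ j Ts ρ ρ' Φ J t (X s) z) * (wNum F γ b₀ p₀ j Ts ρ ρ' Φ J t (X s) z / ∫ z', wNum F γ b₀ p₀ j Ts ρ ρ' Φ J t (X s) z' ∂τ) ∂τ)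
          - (∫ z, (((Real.log (ρ Ts (Φ (V₁, z))) - Real.log (ρ' Ts (Φ (V₁, z)))) - (Real.log (ρ Ts (Φ (U₁, z))) - Real.log (ρ' Ts (Φ (U₁, z))))) * ((Real.log (ρ Ts (Φ (V₁, z))) - Real.log (ρ' Ts (Φ (V₁, z)))) + (Real.log (ρ Ts (Φ (U₁, z))) - Real.log (ρ' Ts (Φ (U₁, z)))))) * (wNum F γ b₀ p₀ j Ts ρ ρ' Φ J t (X s) z / ∫ z', wNum F γ b₀ p₀ j Ts ρ ρ' Φ J t (X s) z' ∂τ) ∂τ) * (∫ z, (deriv (fun s => wNum F γ b₀ p₀ j Ts ρ ρ' Φ J t (X s) z) s / wNum F γ b₀ p₀ j Ts ρ ρ' Φ J t (X s) z) * (wNum F γ b₀ p₀ j Ts ρ ρ' Φ J t (X s) z / ∫ z', wNum F γ b₀ p₀ j Ts ρ ρ' Φ J t (X s) z' ∂τ) ∂τ))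
        - (((∫ z, ((Real.log (ρ Ts (Φ (V₁, z))) - Real.log (ρ' Ts (Φ (V₁, z)))) - (Real.log (ρ Ts (Φ (U₁, z))) - Real.log (ρ' Ts (Φ (U₁, z))))) * (deriv (fun s => wNum F γ b₀ p₀ j Ts ρ ρ' Φ J t (X s) z) s / wNum F γ b₀ p₀ j Ts ρ ρ' Φ J t (X s) z) * (wNum F γ b₀ p₀ j Ts ρ ρ' Φ J t (X s) z / ∫ z', wNum F γ b₀ p₀ j Ts ρ ρ' Φ J t (X s) z' ∂τ) ∂τ)
              - (∫ z, ((Real.log (ρ Ts (Φ (V₁, z))) - Real.log (ρ' Ts (Φ (V₁, z)))) - (Real.log (ρ Ts (Φ (U₁, z))) - Real.log (ρ' Ts (Φ (U₁, z))))) * (wNum F γ b₀ p₀ j Ts ρ ρ' Φ J t (X s) z / ∫ z', wNum F γ b₀ p₀ j Ts ρ ρ' Φ J t (X s) z' ∂τ) ∂τ) * (∫ z, (deriv (fun s => wNum F γ b₀ p₀ j Ts ρ ρ' Φ J t (X s) z) s / wNum F γ b₀ p₀ j Ts ρ ρ' Φ J t (X s) z) * (wNum F γ b₀ p₀ j Ts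 ρ ρ' Φ J t (X s) z / ∫ z', wNum F γ b₀ p₀ j Ts ρ ρ' Φ J t (X s) z' ∂τ) ∂τ))
            * (∫ z, ((Real.log (ρ Ts (Φ (V₁, z))) - Real.log (ρ' Ts (Φ (V₁, z)))) + (Real.log (ρ Ts (Φ (U₁, z))) - Real.log (ρ' Ts (Φ (U₁, z))))) * (wNum F γ b₀ p₀ j Ts ρ ρ' Φ J t (X s) z / ∫ z', wNum F γ b₀ p₀ j Ts ρ ρ' Φ J t (X s) z' ∂τ) ∂τ)
          + (∫ z, ((Real.log (ρ Ts (Φ (V₁, z))) - Real.log (ρ' Ts (Φ (V₁, z)))) - (Real.log (ρ Ts (Φ (U₁, z))) - Real.log (ρ' Ts (Φ (U₁, z))))) * (wNum F γ b₀ p₀ j Ts ρ ρ' Φ J t (X s) z / ∫ z', wNum F γ b₀ p₀ j Ts ρ ρ' Φ J t (X s) z' ∂τ) ∂τ)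
            * ((∫ z, ((Real.log (ρ Ts (Φ (V₁, z))) - Real.log (ρ' Ts (Φ (V₁, z)))) + (Real.log (ρ Ts (Φ (U₁, z))) - Real.log (ρ' Ts (Φ (U₁, z))))) * (deriv (fun s => wNum F γ b₀ p₀ j Ts ρ ρ' Φ J t (X s) z) s / wNum F γ b₀ p₀ j Ts ρ ρ' Φ J t (X s) z) * (wNum F γ b₀ p₀ j Ts ρ ρ' Φ J t (X s) z / ∫ z', wNum F γ b₀ p₀ j Ts ρ ρ' Φ J t (X s) z' ∂τ) ∂τ)
              - (∫ z, ((Real.log (ρ Ts (Φ (V₁, z))) - Real.log (ρ' Ts (Φ (V₁, z)))) + (Real.log (ρ Ts (Φ (U₁, z))) - Real.log (ρ' Ts (Φ (U₁, z))))) * (wNum F γ b₀ p₀ j Ts ρ ρ' Φ J t (X s) z / ∫ z', wNum F γ b₀ p₀ j Ts ρ ρ' Φ J t (X s) z' ∂τ) ∂τ) * (∫ z, (deriv (fun s => wNum F γ b₀ p₀ j Ts ρ ρ' Φ J t (X s) z) s / wNum F γ b₀ p₀ j Ts ρ ρ' Φ J t (X s) z) * (wNum F γ b₀ p₀ j Ts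 ρ ρ' Φ J t (X s) z / ∫ z', wNum F γ b₀ p₀ j Ts ρ ρ' Φ J t (X s) z' ∂τ) ∂τ))))| ≤ ℓ) :
    ∀ (c₁ e₁ c₂ e₂ : ℝ), c₁ = ∫ z, ((Real.log (ρ Ts (Φ (V₁, z))) - Real.log (ρ' Ts (Φ (V₁, z)))) - (Real.log (ρ Ts (Φ (U₁, z))) - Real.log (ρ' Ts (Φ (U₁, z))))) * (wgt F γ b₀ p₀ j Ts ρ ρ' τ Φ J t) W₂ z ∂τ → e₁ = ∫ z, ((Real.log (ρ Ts (Φ (V₁, z))) - Real.log (ρ' Ts (Φ (V₁, z)))) + (Real.log (ρ Ts (Φ (U₁, z))) - Real.log (ρ' Ts (Φ (U₁, z))))) * (wgt F γ b₀ p₀ j Ts ρ ρ' τ Φ J t) W₂ z ∂τ →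
      c₂ = ∫ z, ((Real.log (ρ Ts (Φ (V₁, z))) - Real.log (ρ' Ts (Φ (V₁, z)))) - (Real.log (ρ Ts (Φ (U₁, z))) - Real.log (ρ' Ts (Φ (U₁, z))))) * (wgt F γ b₀ p₀ j Ts ρ ρ' τ Φ J t) U₂ z ∂τ → e₂ = ∫ z, ((Real.log (ρ Ts (Φ (V₁, z))) - Real.log (ρ' Ts (Φ (V₁, z)))) + (Real.log (ρ Ts (Φ (U₁, z))) - Real.log (ρ' Ts (Φ (U₁, z))))) * (wgt F γ b₀ p₀ j Ts ρ ρ' τ Φ J t) U₂ z ∂τ →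
      Integrable (fun z => (((Real.log (ρ Ts (Φ (V₁, z))) - Real.log (ρ' Ts (Φ (V₁, z)))) - (Real.log (ρ Ts (Φ (U₁, z))) - Real.log (ρ' Ts (Φ (U₁, z))))) - c₁) * (((Real.log (ρ Ts (Φ (V₁, z))) - Real.log (ρ' Ts (Φ (V₁, z)))) + (Real.log (ρ Ts (Φ (U₁, z))) - Real.log (ρ' Ts (Φ (U₁, z))))) - e₁) * (wgt F γ b₀ p₀ j Ts ρ ρ' τ Φ J t) W₂ z) τ ∧
      Integrable (fun z => (((Real.log (ρ Ts (Φ (V₁, z))) - Real.log (ρ' Ts (Φ (V₁, z)))) - (Real.log (ρ Ts (Φ (U₁, z))) - Real.log (ρ' Ts (Φ (U₁, z))))) - c₂) * (((Real.log (ρ Ts (Φ (V₁, z))) - Real.log (ρ' Ts (Φ (V₁, z)))) + (Real.log (ρ Ts (Φ (U₁, z))) - Real.log (ρ' Ts (Φ (U₁, z))))) - e₂) * (wgt F γ b₀ p₀ j Ts ρ ρ' τ Φ J t) U₂ z) τ ∧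
      |(∫ z, (((Real.log (ρ Ts (Φ (V₁, z))) - Real.log (ρ' Ts (Φ (V₁, z)))) - (Real.log (ρ Ts (Φ (U₁, z))) - Real.log (ρ' Ts (Φ (U₁, z))))) - c₁) * (((Real.log (ρ Ts (Φ (V₁, z))) - Real.log (ρ' Ts (Φ (V₁, z)))) + (Real.log (ρ Ts (Φ (U₁, z))) - Real.log (ρ' Ts (Φ (U₁, z))))) - e₁) * (wgt F γ b₀ p₀ j Ts ρ ρ' τ Φ J t) W₂ z ∂τ) - (∫ z, (((Real.log (ρ Ts (Φ (V₁, z))) - Real.log (ρ' Ts (Φ (V₁, z)))) - (Real.log (ρ Ts (Φ (U₁, z))) - Real.log (ρ' Ts (Φ (U₁, z))))) - c₂) * (((Real.log (ρ Ts (Φ (V₁, z))) - Real.log (ρ' Ts (Φ (V₁, z)))) + (Real.log (ρ Ts (Φ (U₁, z))) - Real.log (ρ' Ts (Φ (U₁, z))))) - e₂) * (wgt F γ b₀ p₀ j Ts ρ ρ' τ Φ J t) U₂ z ∂τ)| ≤ ℓ := by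
  intro c₁ e₁ c₂ e₂ hc₁ he₁ hc₂ he₂
  have h1 : (1:ℝ) ∈ Icc (0:ℝ) 1 := ⟨zero_le_one, le_rfl⟩
  have h0 : (0:ℝ) ∈ Icc (0:ℝ) 1 := ⟨le_rfl, zero_le_one⟩
  have iDW := integrable_mul_wgt_of_wNum F γ b₀ p₀ j Ts ρ ρ' τ Φ J t (X 1) _ (hiD 1 h1)
  have iSW := integrable_mul_wgt_of_wNum F γ b₀ p₀ j Ts ρ ρ' τ Φ J t (X 1) _ (hiS 1 h1)
  have iDSW := integrable_mul_wgt_of_wNum F γ b₀ p₀ j Ts ρ ρ' τ Φ J t (X 1) _ (hiDS 1 h1)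
  have iDU := integrable_mul_wgt_of_wNum F γ b₀ p₀ j Ts ρ ρ' τ Φ J t (X 0) _ (hiD 0 h0)
  have iSU := integrable_mul_wgt_of_wNum F γ b₀ p₀ j Ts ρ ρ' τ Φ J t (X 0) _ (hiS 0 h0)
  have iDSU := integrable_mul_wgt_of_wNum F γ b₀ p₀ j Ts ρ ρ' τ Φ J t (X 0) _ (hiDS 0 h0)
  have iW1 : Integrable (fun z => (1:ℝ) * (wgt F γ b₀ p₀ j Ts ρ ρ' τ Φ J t) (X 1) z) τ :=
    integrable_mul_wgt_of_wNum F γ b₀ p₀ j Ts ρ ρ' τ Φ J t (X 1) _ (by simpa only [one_mul] using hi 1 h1)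
  have iW0 : Integrable (fun z => (1:ℝ) * (wgt F γ b₀ p₀ j Ts ρ ρ' τ Φ J t) (X 0) z) τ :=
    integrable_mul_wgt_of_wNum F γ b₀ p₀ j Ts ρ ρ' τ Φ J t (X 0) _ (by simpa only [one_mul] using hi 0 h0)
  simp only [one_mul] at iW1 iW0
  have n1 := integral_wgt_eq_one F γ b₀ p₀ j Ts ρ ρ' τ Φ J t (X 1) (hZ 1 h1)
  have n0 := integral_wgt_eq_one F γ b₀ p₀ j Ts ρ ρ' τ Φ J t (X 0) (hZ 0 h0)
  rw [hX1] at iDW iSW iDSW iW1 n1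
  rw [hX0] at iDU iSU iDSU iW0 n0
  have I1 : Integrable (fun z => (((Real.log (ρ Ts (Φ (V₁, z))) - Real.log (ρ' Ts (Φ (V₁, z)))) - (Real.log (ρ Ts (Φ (U₁, z))) - Real.log (ρ' Ts (Φ (U₁, z))))) - c₁) * (((Real.log (ρ Ts (Φ (V₁, z))) - Real.log (ρ' Ts (Φ (V₁, z)))) + (Real.log (ρ Ts (Φ (U₁, z))) - Real.log (ρ' Ts (Φ (U₁, z))))) - e₁) * (wgt F γ b₀ p₀ j Ts ρ ρ' τ Φ J t) W₂ z) τ :=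
    integrable_centred_mul (A := fun z => ((Real.log (ρ Ts (Φ (V₁, z))) - Real.log (ρ' Ts (Φ (V₁, z)))) - (Real.log (ρ Ts (Φ (U₁, z))) - Real.log (ρ' Ts (Φ (U₁, z)))))) (B := fun z => ((Real.log (ρ Ts (Φ (V₁, z))) - Real.log (ρ' Ts (Φ (V₁, z)))) + (Real.log (ρ Ts (Φ (U₁, z))) - Real.log (ρ' Ts (Φ (U₁, z)))))) c₁ e₁ iDW iSW iDSW iW1
  have I2 : Integrable (fun z => (((Real.log (ρ Ts (Φ (V₁, z))) - Real.log (ρ' Ts (Φ (V₁, z)))) - (Real.log (ρ Ts (Φ (U₁, z))) - Real.log (ρ' Ts (Φ (U₁, z))))) - c₂) * (((Real.log (ρ Ts (Φ (V₁, z))) - Real.log (ρ' Ts (Φ (V₁, z)))) + (Real.log (ρ Ts (Φ (U₁, z))) - Real.log (ρ' Ts (Φ (U₁, z))))) - e₂) * (wgt F γ b₀ p₀ j Ts ρ ρ' τ Φ J t) U₂ z) τ :=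
    integrable_centred_mul (A := fun z => ((Real.log (ρ Ts (Φ (V₁, z))) - Real.log (ρ' Ts (Φ (V₁, z)))) - (Real.log (ρ Ts (Φ (U₁, z))) - Real.log (ρ' Ts (Φ (U₁, z)))))) (B := fun z => ((Real.log (ρ Ts (Φ (V₁, z))) - Real.log (ρ' Ts (Φ (V₁, z)))) + (Real.log (ρ Ts (Φ (U₁, z))) - Real.log (ρ' Ts (Φ (U₁, z)))))) c₂ e₂ iDU iSU iDSU iW0
  refine ⟨I1, I2, ?_⟩
  have covW : (∫ z, (((Real.log (ρ Ts (Φ (V₁, z))) - Real.log (ρ' Ts (Φ (V₁, z)))) - (Real.log (ρ Ts (Φ (U₁, z))) - Real.log (ρ' Ts (Φ (U₁, z))))) - c₁) * (((Real.log (ρ Ts (Φ (V₁, z))) - Real.log (ρ' Ts (Φ (V₁, z)))) + (Real.log (ρ Ts (Φ (U₁, z))) - Real.log (ρ' Ts (Φ (U₁, z))))) - e₁) * (wgt F γ b₀ p₀ j Ts ρ ρ' τ Φ J t) W₂ z ∂τ)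
      = (∫ z, (((Real.log (ρ Ts (Φ (V₁, z))) - Real.log (ρ' Ts (Φ (V₁, z)))) - (Real.log (ρ Ts (Φ (U₁, z))) - Real.log (ρ' Ts (Φ (U₁, z))))) * ((Real.log (ρ Ts (Φ (V₁, z))) - Real.log (ρ' Ts (Φ (V₁, z)))) + (Real.log (ρ Ts (Φ (U₁, z))) - Real.log (ρ' Ts (Φ (U₁, z)))))) * (wgt F γ b₀ p₀ j Ts ρ ρ' τ Φ J t) W₂ z ∂τ) - (∫ z, ((Real.log (ρ Ts (Φ (V₁, z))) - Real.log (ρ' Ts (Φ (V₁, z)))) - (Real.log (ρ Ts (Φ (U₁, z))) - Real.log (ρ' Ts (Φ (U₁, z))))) * (wgt F γ b₀ p₀ j Ts ρ ρ' τ Φ J t) W₂ z ∂τ) * (∫ z, ((Real.log (ρ Ts (Φ (V₁, z))) - Real.log (ρ' Ts (Φ (V₁, z)))) + (Real.log (ρ Ts (Φ (U₁, z))) - Real.log (ρ' Ts (Φ (U₁, z))))) * (wgt F γ b₀ p₀ j Ts ρ ρ' τ Φ J t) W₂ z ∂τ) := by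
    rw [hc₁, he₁]
    exact integral_centred_mul_eq (A := fun z => ((Real.log (ρ Ts (Φ (V₁, z))) - Real.log (ρ' Ts (Φ (V₁, z)))) - (Real.log (ρ Ts (Φ (U₁, z))) - Real.log (ρ' Ts (Φ (U₁, z)))))) (B := fun z => ((Real.log (ρ Ts (Φ (V₁, z))) - Real.log (ρ' Ts (Φ (V₁, z)))) + (Real.log (ρ Ts (Φ (U₁, z))) - Real.log (ρ' Ts (Φ (U₁, z)))))) n1 iDW iSW iDSW iW1
  have covU : (∫ z, (((Real.log (ρ Ts (Φ (V₁, z))) - Real.log (ρ' Ts (Φ (V₁, z)))) - (Real.log (ρ Ts (Φ (U₁, z))) - Real.log (ρ' Ts (Φ (U₁, z))))) - c₂) * (((Real.log (ρ Ts (Φ (V₁, z))) - Real.log (ρ' Ts (Φ (V₁, z)))) + (Real.log (ρ Ts (Φ (U₁, z))) - Real.log (ρ' Ts (Φ (U₁, z))))) - e₂) * (wgt F γ b₀ p₀ j Ts ρ ρ' τ Φ J t) U₂ z ∂τ)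
      = (∫ z, (((Real.log (ρ Ts (Φ (V₁, z))) - Real.log (ρ' Ts (Φ (V₁, z)))) - (Real.log (ρ Ts (Φ (U₁, z))) - Real.log (ρ' Ts (Φ (U₁, z))))) * ((Real.log (ρ Ts (Φ (V₁, z))) - Real.log (ρ' Ts (Φ (V₁, z)))) + (Real.log (ρ Ts (Φ (U₁, z))) - Real.log (ρ' Ts (Φ (U₁, z)))))) * (wgt F γ b₀ p₀ j Ts ρ ρ' τ Φ J t) U₂ z ∂τ) - (∫ z, ((Real.log (ρ Ts (Φ (V₁, z))) - Real.log (ρ' Ts (Φ (V₁, z)))) - (Real.log (ρ Ts (Φ (U₁, z))) - Real.log (ρ' Ts (Φ (U₁, z))))) * (wgt F γ b₀ p₀ j Ts ρ ρ' τ Φ J t) U₂ z ∂τ) * (∫ z, ((Real.log (ρ Ts (Φ (V₁, z))) - Real.log (ρ' Ts (Φ (V₁, z)))) + (Real.log (ρ Ts (Φ (U₁, z))) - Real.log (ρ' Ts (Φ (U₁, z))))) * (wgt F γ b₀ p₀ j Ts ρ ρ' τ Φ J t) U₂ z ∂τ) := by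
    rw [hc₂, he₂]
    exact integral_centred_mul_eq (A := fun z => ((Real.log (ρ Ts (Φ (V₁, z))) - Real.log (ρ' Ts (Φ (V₁, z)))) - (Real.log (ρ Ts (Φ (U₁, z))) - Real.log (ρ' Ts (Φ (U₁, z)))))) (B := fun z => ((Real.log (ρ Ts (Φ (V₁, z))) - Real.log (ρ' Ts (Φ (V₁, z)))) + (Real.log (ρ Ts (Φ (U₁, z))) - Real.log (ρ' Ts (Φ (U₁, z)))))) n0 iDU iSU iDSU iW0
  rw [covW, covU]
  rw [integral_mul_wgt_eq_div F γ b₀ p₀ j Ts ρ ρ' τ Φ J t W₂ (fun z => ((Real.log (ρ Ts (Φ (V₁, z))) - Real.log (ρ' Ts (Φ (V₁, z)))) - (Real.log (ρ Ts (Φ (U₁, z))) - Real.log (ρ' Ts (Φ (U₁, z))))) * ((Real.log (ρ Ts (Φ (V₁, z))) - Real.log (ρ' Ts (Φ (V₁, z)))) + (Real.log (ρ Ts (Φ (U₁, z))) - Real.log (ρ' Ts (Φ (U₁, z)))))),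
    integral_mul_wgt_eq_div F γ b₀ p₀ j Ts ρ ρ' τ Φ J t W₂ (fun z => ((Real.log (ρ Ts (Φ (V₁, z))) - Real.log (ρ' Ts (Φ (V₁, z)))) - (Real.log (ρ Ts (Φ (U₁, z))) - Real.log (ρ' Ts (Φ (U₁, z)))))),
    integral_mul_wgt_eq_div F γ b₀ p₀ j Ts ρ ρ' τ Φ J t W₂ (fun z => ((Real.log (ρ Ts (Φ (V₁, z))) - Real.log (ρ' Ts (Φ (V₁, z)))) + (Real.log (ρ Ts (Φ (U₁, z))) - Real.log (ρ' Ts (Φ (U₁, z)))))),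
    integral_mul_wgt_eq_div F γ b₀ p₀ j Ts ρ ρ' τ Φ J t U₂ (fun z => ((Real.log (ρ Ts (Φ (V₁, z))) - Real.log (ρ' Ts (Φ (V₁, z)))) - (Real.log (ρ Ts (Φ (U₁, z))) - Real.log (ρ' Ts (Φ (U₁, z))))) * ((Real.log (ρ Ts (Φ (V₁, z))) - Real.log (ρ' Ts (Φ (V₁, z)))) + (Real.log (ρ Ts (Φ (U₁, z))) - Real.log (ρ' Ts (Φ (U₁, z)))))),
    integral_mul_wgt_eq_div F γ b₀ p₀ j Ts ρ ρ' τ Φ J t U₂ (fun z => ((Real.log (ρ Ts (Φ (V₁, z))) - Real.log (ρ' Ts (Φ (V₁, z)))) - (Real.log (ρ Ts (Φ (U₁, z))) - Real.log (ρ' Ts (Φ (U₁, z)))))),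
    integral_mul_wgt_eq_div F γ b₀ p₀ j Ts ρ ρ' τ Φ J t U₂ (fun z => ((Real.log (ρ Ts (Φ (V₁, z))) - Real.log (ρ' Ts (Φ (V₁, z)))) + (Real.log (ρ Ts (Φ (U₁, z))) - Real.log (ρ' Ts (Φ (U₁, z))))))]
  have hraw : ∀ᵐ s ∂(volume : Measure ℝ), s ∈ Icc (0:ℝ) 1 →
      |((∫ z, (((Real.log (ρ Ts (Φ (V₁, z))) - Real.log (ρ' Ts (Φ (V₁, z)))) - (Real.log (ρ Ts (Φ (U₁, z))) - Real.log (ρ' Ts (Φ (U₁, z))))) * ((Real.log (ρ Ts (Φ (V₁, z))) - Real.log (ρ' Ts (Φ (V₁, z)))) + (Real.log (ρ Ts (Φ (U₁, z))) - Real.log (ρ' Ts (Φ (U₁, z)))))) * deriv (fun s => wNum F γ b₀ p₀ j Ts ρ ρ' Φ J t (X s) z) s ∂τ) / (∫ z, wNum F γ b₀ p₀ j Ts ρ ρ' Φ J t (X s) z ∂τ)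
          - ((∫ z, (((Real.log (ρ Ts (Φ (V₁, z))) - Real.log (ρ' Ts (Φ (V₁, z)))) - (Real.log (ρ Ts (Φ (U₁, z))) - Real.log (ρ' Ts (Φ (U₁, z))))) * ((Real.log (ρ Ts (Φ (V₁, z))) - Real.log (ρ' Ts (Φ (V₁, z)))) + (Real.log (ρ Ts (Φ (U₁, z))) - Real.log (ρ' Ts (Φ (U₁, z)))))) * wNum F γ b₀ p₀ j Ts ρ ρ' Φ J t (X s) z ∂τ) / (∫ z, wNum F γ b₀ p₀ j Ts ρ ρ' Φ J t (X s) z ∂τ)) * ((∫ z, deriv (fun s => wNum F γ b₀ p₀ j Ts ρ ρ' Φ J t (X s) z) s ∂τ) / (∫ z, wNum F γ b₀ p₀ j Ts ρ ρ' Φ J t (X s) z ∂τ)))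
        - (((∫ z, ((Real.log (ρ Ts (Φ (V₁, z))) - Real.log (ρ' Ts (Φ (V₁, z)))) - (Real.log (ρ Ts (Φ (U₁, z))) - Real.log (ρ' Ts (Φ (U₁, z))))) * deriv (fun s => wNum F γ b₀ p₀ j Ts ρ ρ' Φ J t (X s) z) s ∂τ) / (∫ z, wNum F γ b₀ p₀ j Ts ρ ρ' Φ J t (X s) z ∂τ)
              - ((∫ z, ((Real.log (ρ Ts (Φ (V₁, z))) - Real.log (ρ' Ts (Φ (V₁, z)))) - (Real.log (ρ Ts (Φ (U₁, z))) - Real.log (ρ' Ts (Φ (U₁, z))))) * wNum F γ b₀ p₀ j Ts ρ ρ' Φ J t (X s) z ∂τ) / (∫ z, wNum F γ b₀ p₀ j Ts ρ ρ' Φ J t (X s) z ∂τ)) * ((∫ z, deriv (fun s => wNum F γ b₀ p₀ j Ts ρ ρ' Φ J t (X s) z) s ∂τ) / (∫ z, wNum F γ b₀ p₀ j Ts ρ ρ' Φ J t (X s) z ∂τ)))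
            * ((∫ z, ((Real.log (ρ Ts (Φ (V₁, z))) - Real.log (ρ' Ts (Φ (V₁, z)))) + (Real.log (ρ Ts (Φ (U₁, z))) - Real.log (ρ' Ts (Φ (U₁, z))))) * wNum F γ b₀ p₀ j Ts ρ ρ' Φ J t (X s) z ∂τ) / (∫ z, wNum F γ b₀ p₀ j Ts ρ ρ' Φ J t (X s) z ∂τ))
          + ((∫ z, ((Real.log (ρ Ts (Φ (V₁, z))) - Real.log (ρ' Ts (Φ (V₁, z)))) - (Real.log (ρ Ts (Φ (U₁, z))) - Real.log (ρ' Ts (Φ (U₁, z))))) * wNum F γ b₀ p₀ j Ts ρ ρ' Φ J t (X s) z ∂τ) / (∫ z, wNum F γ b₀ p₀ j Ts ρ ρ' Φ J t (X s) z ∂τ))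
            * ((∫ z, ((Real.log (ρ Ts (Φ (V₁, z))) - Real.log (ρ' Ts (Φ (V₁, z)))) + (Real.log (ρ Ts (Φ (U₁, z))) - Real.log (ρ' Ts (Φ (U₁, z))))) * deriv (fun s => wNum F γ b₀ p₀ j Ts ρ ρ' Φ J t (X s) z) s ∂τ) / (∫ z, wNum F γ b₀ p₀ j Ts ρ ρ' Φ J t (X s) z ∂τ)
              - ((∫ z, ((Real.log (ρ Ts (Φ (V₁, z))) - Real.log (ρ' Ts (Φ (V₁, z)))) + (Real.log (ρ Ts (Φ (U₁, z))) - Real.log (ρ' Ts (Φ (U₁, z))))) * wNum F γ b₀ p₀ j Ts ρ ρ' Φ J t (X s) z ∂τ) / (∫ z, wNum F γ b₀ p₀ j Ts ρ ρ' Φ J t (X s) z ∂τ)) * ((∫ z, deriv (fun s => wNum F γ b₀ p₀ j Ts ρ ρ' Φ J t (X s) z) s ∂τ) / (∫ z, wNum F γ b₀ p₀ j Ts ρ ρ' Φ J t (X s) z ∂τ))))| ≤ ℓ := by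
    filter_upwards [ae_ae_hasDerivAt_deriv_of_lipschitzOn (w := fun s z => wNum F γ b₀ p₀ j Ts ρ ρ' Φ J t (X s) z) hU hUI τ hwm hlip, hcum] with s hs hc hsI
    have hnull := cut_null_of_nonneg (w := fun s z => wNum F γ b₀ p₀ j Ts ρ ρ' Φ J t (X s) z) (w'₀ := fun z => deriv (fun s => wNum F γ b₀ p₀ j Ts ρ ρ' Φ J t (X s) z) s) (s₀ := s) hw0 (hs hsI)
    rw [normCov_deriv_eq_cum3_of_null (w := fun s z => wNum F γ b₀ p₀ j Ts ρ ρ' Φ J t (X s) z) (w' := fun s z => deriv (fun s => wNum F γ b₀ p₀ j Ts ρ ρ' Φ J t (X s) z) s) (A := fun z => ((Real.log (ρ Ts (Φ (V₁, z))) - Real.log (ρ' Ts (Φ (V₁, z)))) - (Real.log (ρ Ts (Φ (U₁, z))) - Real.log (ρ' Ts (Φ (U₁, z)))))) (B := fun z => ((Real.log (ρ Ts (Φ (V₁, z))) - Real.log (ρ' Ts (Φ (V₁, z)))) + (Real.log (ρ Ts (Φ (U₁, z))) - Real.log (ρ' Ts (Φ (U₁, z)))))) (s₀ := s) hnull]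
    exact hc hsI
  have hedge := abs_normCov_one_sub_zero_le_of_lip_ae (w := fun s z => wNum F γ b₀ p₀ j Ts ρ ρ' Φ J t (X s) z) (A := fun z => ((Real.log (ρ Ts (Φ (V₁, z))) - Real.log (ρ' Ts (Φ (V₁, z)))) - (Real.log (ρ Ts (Φ (U₁, z))) - Real.log (ρ' Ts (Φ (U₁, z)))))) (B := fun z => ((Real.log (ρ Ts (Φ (V₁, z))) - Real.log (ρ' Ts (Φ (V₁, z)))) + (Real.log (ρ Ts (Φ (U₁, z))) - Real.log (ρ' Ts (Φ (U₁, z)))))) hU hUI hmD hmS hwm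
    hi hiD hiS hiDS hlip hbi hlipD hbDi hlipS hbSi hlipDS hbDSi hZ hraw
  rw [hX0, hX1] at hedge
  exact hedge

end CovEdge

end Summit.QuantumFields.YangMills.Theorems.OrganTangentLawEdgeIntegrationLipAE

end
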